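import Literature.Analysis.Quadrature.KorobovBernoulliForm

/-!
# Component-by-component construction of rank-1 lattice rules in weighted Korobov spaces
# (Dick–Pillichshammer 2014, §9.4.1, Algorithm 20 and Theorem 21(1); Kuo 2003)

Let `N` be a prime, `α > 1` a (real) smoothness parameter and `γ = (γ_i)_i` nonnegative product
weights.  By Theorem 15 of J. Dick and F. Pillichshammer, *Discrepancy theory and quasi-Monte
Carlo integration*, Chapter 9 of W. Chen, A. Srivastav, G. Travaglini (eds.), *A Panorama of
Discrepancy Theory*, Lecture Notes in Math. 2107, Springer 2014, §9.4.1, the squared worst-case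
error of the rank-1 lattice rule `P(g, N)` in the weighted Korobov space `H(K_{s,α,γ})` is the
dual-lattice sum

  `e²(H(K_{s,α,γ}); P(g, N)) = Σ_{𝐡 ∈ L_{g,N} ∖ {0}} r_{α,γ}(𝐡)^{-1}`,
  `r_{α,γ}(𝐡)^{-1} = ∏_{i : h_i ≠ 0} γ_i / |h_i|^α`                       (`weightedPFigureR α γ g N`)

(for integer `α` this is `weightedPFigure` of `Literature.Analysis.Quadrature.KorobovBernoulliForm`,
see `weightedPFigure_eq_weightedPFigureR`; DP14 allow any real `α > 1`).

**Algorithm 20** (component-by-component construction; Korobov [60], Sloan–Reztsov [107]):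
`g_1 = 1`; given `g_1, …, g_{d-1}`, choose `g_d ∈ {1, …, N-1}` minimising
`e²(H(K_{s,α,γ}); P((g_1, …, g_{d-1}, z), N))` as a function of `z ∈ {1, …, N-1}`.  We encode the
output by the predicate `IsCBC α N γ g` ("every component `g_d ∈ {1, …, N-1}` minimises the
`d`-dimensional squared worst-case error given `g_1, …, g_{d-1}`"); for `d = 1` every
`z ∈ {1, …, N-1}` gives the same error (`isCBCStep_zero_iff`), so the choice `g_1 = 1` of step 1
is a minimiser and Algorithm 20's output satisfies `IsCBC` (`exists_isCBC_apply_zero_eq_one`).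

**Theorem 21(1)** (Kuo [66] = F. Y. Kuo, J. Complexity 19 (2003) 301–320): for prime `N`, a
vector `g` found by Algorithm 20 satisfies, for `1/α < λ ≤ 1`,

  `e²(H(K_{s,α,γ}); P(g, N)) ≤ (2/N)^{1/λ} ∏_{i=1}^s (1 + 2 γ_i^λ ζ(αλ))^{1/λ}`

(`weightedPFigureR_le_of_isCBC`).  We prove it by the standard induction (the averaging
argument of Kuo, in the form of Lemma 1 / Theorem 2 of A. Ebert, H. Leövey, D. Nuyens,
arXiv:1703.06334, and of Theorem 3 of D. Nuyens, arXiv:1308.3601): writing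
`e²_{d}((g', g_d)) = e²_{d-1}(g') + θ(g_d)`, the minimiser satisfies
`θ(g_d)^λ ≤ (N-1)^{-1} Σ_{z=1}^{N-1} θ_λ(z) ≤ (N-1)^{-1} 2γ_d^λ ζ(αλ) ∏_{j<d} (1 + 2γ_j^λ ζ(αλ))`
where `θ_λ` is `θ` for the parameters `(αλ, γ^λ)` ("Jensen's inequality"
`(Σ a_k)^λ ≤ Σ a_k^λ`), whence the inductive invariant
`e²_d(g)^λ ≤ ((∏_{j ≤ d} (1 + 2γ_j^λ ζ(αλ))) - 1)/(N - 1)` (`weightedPFigureR_rpow_le_of_isCBC`),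
which implies the sharper intermediate form `e² ≤ ((N-1)^{-1} ∏_i (1 + 2γ_i^λ ζ(αλ)))^{1/λ}`
(`weightedPFigureR_le_of_isCBC_sharp`) and, as `(N-1)^{-1} ≤ 2/N`, the displayed bound of
Theorem 21(1).  The unweighted case `γ = (1, 1, …)` is Niederreiter's `P_α(g, N)`
(`pFigure_le_of_isCBC`); the strong-tractability form `(2/N)^{1/λ} exp(λ^{-1} Σ_i 2γ_i^λ ζ(αλ))`
of the display following Theorem 21 is `weightedPFigureR_le_exp_of_isCBC`.

References (bib keys): J. Dick, F. Pillichshammer, in: A Panorama of Discrepancy Theory, LNM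
2107 (2014) 539–619, doi:10.1007/978-3-319-04696-9_9 (`DickPillichshammer2014`), §9.4.1,
Algorithm 20 and Theorem 21; F. Y. Kuo, J. Complexity 19 (2003) 301–320 (as cited there, [66]);
D. Nuyens, in: Uniform Distribution and Quasi-Monte Carlo Methods, De Gruyter (2014),
arXiv:1308.3601, Theorem 3; A. Ebert, H. Leövey, D. Nuyens, arXiv:1703.06334, Lemma 1.

AI-produced formalisation (H21 engines group, seat eng-quad-1, 2026-08-20); no facts, no axioms
beyond Mathlib's, no `sorry`.
-/

open scoped Real
open Finset

noncomputable section

namespace Literature.Analysis.Quadrature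

variable {d : Type*} [Fintype d]

/-! ### The weights `r_{α,γ}(𝐡)^{-1}` for a real smoothness parameter `α` -/

/-- The one-dimensional factor `r_{α,γ}(h)^{-1}`: `1` for `h = 0` and `γ / |h|^α` for `h ≠ 0`
(real `α`). [cite: DickPillichshammer2014, Thm. 15] -/
def korobovFactor (a γ : ℝ) (q : ℤ) : ℝ :=
  if q = 0 then 1 else γ / |(q : ℝ)| ^ a

/-- `r_{α,γ}(𝐡)^{-1} = ∏_i r_{α,γ_i}(h_i)^{-1}` for a real smoothness parameter `α`
(the space `K_{s,α,γ}` of §9.4.1 is defined for every real `α > 1`).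
[cite: DickPillichshammer2014, Thm. 15] -/
def korobovWeightR (a : ℝ) (γ : d → ℝ) (h : d → ℤ) : ℝ :=
  ∏ i, korobovFactor a (γ i) (h i)

/-- `e²(H(K_{s,α,γ}); P(g, N)) = Σ_{𝐡 ∈ L_{g,N} ∖ {0}} r_{α,γ}(𝐡)^{-1}` (Theorem 15), for a real
smoothness parameter `α`. [cite: DickPillichshammer2014, Thm. 15] -/
def weightedPFigureR (a : ℝ) (γ : d → ℝ) (g : d → ℤ) (N : ℕ) : ℝ :=
  ∑' h : ((dualLattice N g : Set (d → ℤ)) \ {0} : Set (d → ℤ)), korobovWeightR a γ h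

/-- For integer `α` the real-parameter weights are those of `KorobovBernoulliForm`.
[cite: DickPillichshammer2014, Thm. 15] -/
theorem korobovWeight_eq_korobovWeightR (α : ℕ) (γ : d → ℝ) (h : d → ℤ) :
    korobovWeight α γ h = korobovWeightR α γ h := by
  unfold korobovWeight korobovWeightR korobovFactor
  refine Finset.prod_congr rfl fun i _ => ?_
  rw [Real.rpow_natCast]

/-- For integer `α`, `weightedPFigure α = weightedPFigureR α`. [cite: DickPillichshammer2014, Thm. 15] -/
theorem weightedPFigure_eq_weightedPFigureR (α : ℕ) (γ : d → ℝ) (g : d → ℤ) (N : ℕ) :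
    weightedPFigure α γ g N = weightedPFigureR α γ g N := by
  simp only [weightedPFigure, weightedPFigureR, korobovWeight_eq_korobovWeightR]

/-- `r_{α,γ}(0)^{-1} = 1`. [cite: DickPillichshammer2014, Thm. 15] -/
theorem korobovFactor_zero (a γ : ℝ) : korobovFactor a γ 0 = 1 := if_pos rfl

/-- `r_{α,γ}(h)^{-1} = γ / |h|^α` for `h ≠ 0`. [cite: DickPillichshammer2014, Thm. 15] -/
theorem korobovFactor_of_ne_zero (a γ : ℝ) {q : ℤ} (hq : q ≠ 0) :
    korobovFactor a γ q = γ / |(q : ℝ)| ^ a := if_neg hq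

/-- `r_{α,γ}(h)^{-1} = γ · max(1, |h|)^{-α}` for `h ≠ 0`. [folklore] -/
private theorem korobovFactor_eq_mul_inv (a γ : ℝ) {q : ℤ} (hq : q ≠ 0) :
    korobovFactor a γ q = γ * ((max 1 |(q : ℝ)|) ^ a)⁻¹ := by
  have h1 : (1 : ℝ) ≤ |(q : ℝ)| := by exact_mod_cast Int.one_le_abs hq
  rw [korobovFactor_of_ne_zero a γ hq, max_eq_right h1, div_eq_mul_inv]

/-- `r_{α,γ}(h)^{-1} ≥ 0` for `γ ≥ 0`. [folklore] -/
private theorem korobovFactor_nonneg (a : ℝ) {γ : ℝ} (hγ : 0 ≤ γ) (q : ℤ) : 0 ≤ korobovFactor a γ q := by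
  unfold korobovFactor
  split_ifs
  · exact zero_le_one
  · positivity

/-- In the unweighted case `γ = 1`, `r_{α,1}(h)^{-1} = max(1, |h|)^{-α}`. [cite: DickPillichshammer2014, Thm. 15] -/
theorem korobovFactor_one (a : ℝ) (q : ℤ) : korobovFactor a 1 q = ((max 1 |(q : ℝ)|) ^ a)⁻¹ := by
  rcases eq_or_ne q 0 with rfl | hq
  · rw [korobovFactor_zero, Int.cast_zero, abs_zero, max_eq_left (zero_le_one' ℝ), Real.one_rpow,
      inv_one]
  · rw [korobovFactor_eq_mul_inv a 1 hq, one_mul]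

/-- `|r_{α,γ}(h)^{-1}| ≤ max(1, |γ|) · max(1, |h|)^{-α}`. [folklore] -/
private theorem abs_korobovFactor_le (a γ : ℝ) (q : ℤ) :
    |korobovFactor a γ q| ≤ max 1 |γ| * ((max 1 |(q : ℝ)|) ^ a)⁻¹ := by
  rcases eq_or_ne q 0 with rfl | hq
  · rw [korobovFactor_zero, Int.cast_zero, abs_zero, max_eq_left (zero_le_one' ℝ), Real.one_rpow,
      inv_one, mul_one, abs_one]
    exact le_max_left _ _
  · have hm : (0 : ℝ) ≤ ((max 1 |(q : ℝ)|) ^ a)⁻¹ := by positivity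
    rw [korobovFactor_eq_mul_inv a γ hq, abs_mul, abs_of_nonneg hm]
    gcongr
    exact le_max_right _ _

/-- `(r_{α,γ}(h)^{-1})^λ = r_{αλ,γ^λ}(h)^{-1}` (`γ ≥ 0`): the substitution behind "Jensen's
inequality" in the proof of Theorem 21(1). [cite: DickPillichshammer2014, Thm. 21] -/
theorem korobovFactor_rpow (a : ℝ) {γ : ℝ} (hγ : 0 ≤ γ) (q : ℤ) (l : ℝ) :
    korobovFactor a γ q ^ l = korobovFactor (a * l) (γ ^ l) q := by
  unfold korobovFactor
  split_ifs with hq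
  · exact Real.one_rpow l
  · rw [Real.div_rpow hγ (by positivity), ← Real.rpow_mul (abs_nonneg _)]

/-- `r_{α,γ}(𝐡)^{-1} ≥ 0` for nonnegative weights. [cite: DickPillichshammer2014, Thm. 15] -/
theorem korobovWeightR_nonneg (a : ℝ) {γ : d → ℝ} (hγ : ∀ i, 0 ≤ γ i) (h : d → ℤ) :
    0 ≤ korobovWeightR a γ h :=
  Finset.prod_nonneg fun i _ => korobovFactor_nonneg a (hγ i) (h i)

/-- `(r_{α,γ}(𝐡)^{-1})^λ = r_{αλ,γ^λ}(𝐡)^{-1}` with `γ^λ = (γ_i^λ)_i`.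
[cite: DickPillichshammer2014, Thm. 21] -/
theorem korobovWeightR_rpow (a : ℝ) {γ : d → ℝ} (hγ : ∀ i, 0 ≤ γ i) (h : d → ℤ) (l : ℝ) :
    korobovWeightR a γ h ^ l = korobovWeightR (a * l) (fun i => γ i ^ l) h := by
  unfold korobovWeightR
  rw [← Real.finsetProd_rpow _ _ (fun i _ => korobovFactor_nonneg a (hγ i) (h i))]
  exact Finset.prod_congr rfl fun i _ => korobovFactor_rpow a (hγ i) (h i) l

/-- In the unweighted case `r_{α,1}(𝐡)^{-1} = r(𝐡)^{-α}` (Niederreiter's `r(𝐡) = ∏ max(1, |h_j|)`).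
[cite: DickPillichshammer2014, Thm. 15] -/
theorem korobovWeightR_one (a : ℝ) (h : d → ℤ) :
    korobovWeightR a (fun _ => 1) h = (rWeight h ^ a)⁻¹ := by
  rw [rWeight_rpow_inv_eq_prod, korobovWeightR]
  exact Finset.prod_congr rfl fun j _ => korobovFactor_one a (h j)

/-- `P_α(g, N) = e²` of the unweighted Korobov space. [cite: DickPillichshammer2014, Thm. 15] -/
theorem pFigure_eq_weightedPFigureR (a : ℝ) (g : d → ℤ) (N : ℕ) :
    pFigure a g N = weightedPFigureR a (fun _ => 1) g N := by
  simp only [pFigure, weightedPFigureR, korobovWeightR_one]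

/-- `|r_{α,γ}(𝐡)^{-1}| ≤ (∏_i max(1, |γ_i|)) · r(𝐡)^{-α}`. [folklore] -/
private theorem abs_korobovWeightR_le (a : ℝ) (γ : d → ℝ) (h : d → ℤ) :
    |korobovWeightR a γ h| ≤ (∏ i, max 1 |γ i|) * (rWeight h ^ a)⁻¹ := by
  rw [korobovWeightR, Finset.abs_prod, rWeight_rpow_inv_eq_prod, ← Finset.prod_mul_distrib]
  exact Finset.prod_le_prod (fun i _ => abs_nonneg _) fun i _ => abs_korobovFactor_le a (γ i) (h i)

/-- `Σ_{𝐡 ∈ ℤᵈ} r_{α,γ}(𝐡)^{-1}` converges absolutely for `α > 1`.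
[cite: DickPillichshammer2014, Thm. 15] -/
theorem summable_korobovWeightR {a : ℝ} (ha : 1 < a) (γ : d → ℝ) :
    Summable (korobovWeightR a γ) := by
  refine Summable.of_norm_bounded
    ((summable_rWeight_rpow_inv (d := d) ha).mul_left (∏ i, max 1 |γ i|)) fun h => ?_
  rw [Real.norm_eq_abs]
  exact abs_korobovWeightR_le a γ _

/-- Truncations `𝐡 ↦ [p 𝐡] r_{α,γ}(𝐡)^{-1}` of the weights are summable (`α > 1`). [folklore] -/
private theorem summable_ite_korobovWeightR {a : ℝ} (ha : 1 < a) (γ : d → ℝ) (p : (d → ℤ) → Prop)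
    [DecidablePred p] : Summable fun h => if p h then korobovWeightR a γ h else 0 := by
  refine Summable.of_norm_bounded (summable_korobovWeightR ha γ).norm fun h => ?_
  split_ifs
  · exact le_rfl
  · rw [norm_zero]
    exact norm_nonneg _

/-- For `α > 1` the series `Σ_{𝐡 ∈ L_{g,N} ∖ {0}} r_{α,γ}(𝐡)^{-1}` converges, to
`weightedPFigureR α γ g N`. [cite: DickPillichshammer2014, Thm. 15] -/
theorem hasSum_weightedPFigureR {a : ℝ} (ha : 1 < a) (γ : d → ℝ) (g : d → ℤ) (N : ℕ) :
    HasSum (fun h : ((dualLattice N g : Set (d → ℤ)) \ {0} : Set (d → ℤ)) =>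
      korobovWeightR a γ h) (weightedPFigureR a γ g N) :=
  ((summable_korobovWeightR ha γ).subtype _).hasSum

/-- `e² ≥ 0` for nonnegative weights. [cite: DickPillichshammer2014, Thm. 15] -/
theorem weightedPFigureR_nonneg (a : ℝ) {γ : d → ℝ} (hγ : ∀ i, 0 ≤ γ i) (g : d → ℤ) (N : ℕ) :
    0 ≤ weightedPFigureR a γ g N :=
  tsum_nonneg fun _ => korobovWeightR_nonneg a hγ _

/-! ### One-dimensional sums: `Σ_{h ∈ ℤ} r_{α,γ}(h)^{-1} = 1 + 2γζ(α)` -/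

/-- `ζ(α) ≥ 0`. [folklore] -/
private theorem zetaReal_nonneg' (k : ℝ) : 0 ≤ zetaReal k :=
  tsum_nonneg fun n => inv_nonneg.mpr (Real.rpow_nonneg (Nat.cast_nonneg n) k)

/-- `Σ_{h ∈ ℤ} r_{α,γ}(h)^{-1} = 1 + 2γζ(α)` for `α > 1` (the factor `1 + 2γ_i ζ(·)` of Theorem
21(1)). [cite: DickPillichshammer2014, Thm. 21] -/
theorem hasSum_korobovFactor {b : ℝ} (hb : 1 < b) (γ : ℝ) :
    HasSum (fun q : ℤ => korobovFactor b γ q) (1 + 2 * γ * zetaReal b) := by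
  have h0 := ((hasSum_int_max_one_abs_rpow_inv hb).mul_left γ).update 0 1
  have e0 : ((max 1 |((0 : ℤ) : ℝ)|) ^ b)⁻¹ = 1 := by
    rw [Int.cast_zero, abs_zero, max_eq_left (zero_le_one' ℝ), Real.one_rpow, inv_one]
  rw [e0, mul_one, show 1 - γ + γ * (1 + 2 * zetaReal b) = 1 + 2 * γ * zetaReal b by ring] at h0
  refine h0.congr_fun fun q => ?_
  rcases eq_or_ne q 0 with rfl | hq
  · rw [Function.update_self, korobovFactor_zero]
  · rw [Function.update_of_ne hq, korobovFactor_eq_mul_inv b γ hq]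

/-- `Σ_{h ∈ ℤ ∖ {0}} r_{α,γ}(h)^{-1} = 2γζ(α)` for `α > 1`. [cite: DickPillichshammer2014, Thm. 21] -/
theorem hasSum_korobovFactor_ite {b : ℝ} (hb : 1 < b) (γ : ℝ) :
    HasSum (fun q : ℤ => if q = 0 then 0 else korobovFactor b γ q) (2 * γ * zetaReal b) := by
  have h := hasSum_ite_sub_hasSum (hasSum_korobovFactor hb γ) 0
  rwa [korobovFactor_zero, show 1 + 2 * γ * zetaReal b - 1 = 2 * γ * zetaReal b by ring] at h

/-- For nonnegative summable `φᵢ : ℤ → ℝ`, every finite partial sum of `Σ_{𝐪 ∈ ℤᵈ} ∏ᵢ φᵢ(qᵢ)` is at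
most `∏ᵢ Σ_{n ∈ ℤ} φᵢ(n)`. [folklore] -/
private theorem sum_prod_le_prod_tsum' {φ : d → ℤ → ℝ} (h0 : ∀ i n, 0 ≤ φ i n)
    (hs : ∀ i, Summable (φ i)) (Q : Finset (d → ℤ)) :
    ∑ q ∈ Q, ∏ i, φ i (q i) ≤ ∏ i, ∑' n, φ i n := by
  classical
  let T : Finset ℤ := Q.biUnion fun q => Finset.univ.image q
  have hQ : Q ⊆ Fintype.piFinset fun _ : d => T := by
    intro q hq
    rw [Fintype.mem_piFinset]
    intro i
    exact Finset.mem_biUnion.mpr ⟨q, hq, Finset.mem_image.mpr ⟨i, Finset.mem_univ _, rfl⟩⟩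
  calc ∑ q ∈ Q, ∏ i, φ i (q i)
      ≤ ∑ q ∈ Fintype.piFinset (fun _ : d => T), ∏ i, φ i (q i) :=
        Finset.sum_le_sum_of_subset_of_nonneg hQ fun q _ _ =>
          Finset.prod_nonneg fun i _ => h0 i (q i)
    _ = ∏ i, ∑ n ∈ T, φ i n := (Finset.prod_univ_sum (fun _ : d => T) φ).symm
    _ ≤ ∏ i, ∑' n, φ i n := by
        refine Finset.prod_le_prod (fun i _ => Finset.sum_nonneg fun n _ => h0 i n) fun i _ => ?_
        exact (hs i).sum_le_tsum T fun n _ => h0 i n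

/-- Every finite partial sum of `Σ_{𝐡 ∈ ℤᵈ} r_{α,γ}(𝐡)^{-1}` is at most `∏_i (1 + 2γ_i ζ(α))`
(`α > 1`, `γ ≥ 0`). [cite: DickPillichshammer2014, Thm. 21] -/
theorem sum_korobovWeightR_le {b : ℝ} (hb : 1 < b) {δ : d → ℝ} (hδ : ∀ i, 0 ≤ δ i)
    (Q : Finset (d → ℤ)) :
    ∑ h ∈ Q, korobovWeightR b δ h ≤ ∏ i, (1 + 2 * δ i * zetaReal b) := by
  refine (sum_prod_le_prod_tsum' (fun i n => korobovFactor_nonneg b (hδ i) n)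
    (fun i => (hasSum_korobovFactor hb (δ i)).summable) Q).trans_eq ?_
  exact Finset.prod_congr rfl fun i _ => (hasSum_korobovFactor hb (δ i)).tsum_eq

/-! ### The candidate set `{1, …, N-1}` and the counting lemma behind the averaging argument -/

/-- The candidate set `{1, …, N-1}` for a component `g_d` in Algorithm 20.
[cite: DickPillichshammer2014, Thm. 21] -/
def cbcCandidates (N : ℕ) : Finset ℤ :=
  Finset.Icc 1 ((N : ℤ) - 1)

/-- `w ∈ {1, …, N-1} ↔ 1 ≤ w ≤ N - 1`. [cite: DickPillichshammer2014, Thm. 21] -/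
theorem mem_cbcCandidates {N : ℕ} {w : ℤ} : w ∈ cbcCandidates N ↔ 1 ≤ w ∧ w ≤ (N : ℤ) - 1 :=
  Finset.mem_Icc

/-- `#{1, …, N-1} = N - 1`. [cite: DickPillichshammer2014, Thm. 21] -/
theorem card_cbcCandidates (N : ℕ) : (cbcCandidates N).card = N - 1 := by
  rw [cbcCandidates, Int.card_Icc]
  omega

/-- No element of `{1, …, N-1}` is divisible by `N`. [folklore] -/
private theorem not_dvd_of_mem_cbcCandidates {N : ℕ} {w : ℤ} (hw : w ∈ cbcCandidates N) :
    ¬ (N : ℤ) ∣ w := by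
  rw [mem_cbcCandidates] at hw
  intro h
  have := Int.le_of_dvd (by omega) h
  omega

/-- For a prime `N` and `N ∤ t`, the congruence `c + t w ≡ 0 (mod N)` has at most one solution
`w ∈ {1, …, N-1}` (the count used in Kuo's averaging argument). [cite: DickPillichshammer2014, Thm. 21] -/
theorem card_filter_dvd_le_one {N : ℕ} (hN : N.Prime) {t : ℤ} (ht : ¬ (N : ℤ) ∣ t) (c : ℤ) :
    #{w ∈ cbcCandidates N | (N : ℤ) ∣ c + t * w} ≤ 1 := by
  refine Finset.card_le_one.mpr fun w₁ hw₁ w₂ hw₂ => ?_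
  rw [Finset.mem_filter, mem_cbcCandidates] at hw₁ hw₂
  have hp : Prime (N : ℤ) := Nat.prime_iff_prime_int.mp hN
  have h1 : (N : ℤ) ∣ t * (w₁ - w₂) := by
    have := dvd_sub hw₁.2 hw₂.2
    rwa [show c + t * w₁ - (c + t * w₂) = t * (w₁ - w₂) by ring] at this
  rcases hp.dvd_or_dvd h1 with h | h
  · exact absurd h ht
  · have h2 : w₁ - w₂ = 0 := Int.eq_zero_of_abs_lt_dvd h (by rw [abs_lt]; constructor <;> omega)
    omega

/-- If `N ∣ c` and `N ∤ t` (prime `N`), no `w ∈ {1, …, N-1}` solves `c + t w ≡ 0 (mod N)`.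
[folklore] -/
private theorem filter_dvd_eq_empty_of_dvd {N : ℕ} (hN : N.Prime) {c t : ℤ} (hc : (N : ℤ) ∣ c)
    (ht : ¬ (N : ℤ) ∣ t) : {w ∈ cbcCandidates N | (N : ℤ) ∣ c + t * w} = ∅ := by
  refine Finset.filter_eq_empty_iff.mpr fun w hw hdvd => ?_
  have hp : Prime (N : ℤ) := Nat.prime_iff_prime_int.mp hN
  have h1 : (N : ℤ) ∣ t * w := (dvd_add_right hc).mp hdvd
  rcases hp.dvd_or_dvd h1 with h2 | h2
  · exact ht h2
  · exact not_dvd_of_mem_cbcCandidates hw h2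

/-- If `N ∤ c` and `N ∣ t`, no `w` solves `c + t w ≡ 0 (mod N)`. [folklore] -/
private theorem filter_dvd_eq_empty_of_not_dvd {N : ℕ} {c t : ℤ} (hc : ¬ (N : ℤ) ∣ c)
    (ht : (N : ℤ) ∣ t) : {w ∈ cbcCandidates N | (N : ℤ) ∣ c + t * w} = ∅ := by
  refine Finset.filter_eq_empty_iff.mpr fun w _ hdvd => hc ?_
  have := dvd_sub hdvd (ht.mul_right w)
  rwa [add_sub_cancel_right] at this

/-- The multiples of `N` contribute `Σ_{t ≠ 0, N ∣ t} r_{α,γ}(t)^{-1} ≤ N^{-α} · 2γζ(α)` to any finite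
partial sum. [folklore] -/
private theorem sum_korobovFactor_multiples_le {b : ℝ} (hb : 1 < b) {δ : ℝ} (hδ : 0 ≤ δ) {N : ℕ}
    (hN : 0 < N) (T : Finset ℤ) :
    ∑ t ∈ T with t ≠ 0 ∧ (N : ℤ) ∣ t, korobovFactor b δ t ≤
      ((N : ℝ) ^ b)⁻¹ * (2 * δ * zetaReal b) := by
  have hN0 : (N : ℤ) ≠ 0 := by exact_mod_cast hN.ne'
  have key : ∀ t ∈ T.filter (fun t => t ≠ 0 ∧ (N : ℤ) ∣ t),
      korobovFactor b δ t = ((N : ℝ) ^ b)⁻¹ * korobovFactor b δ (t / N) := by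
    intro t ht
    obtain ⟨ht0, m, hm⟩ := (Finset.mem_filter.mp ht).2
    have hm0 : m ≠ 0 := by
      rintro rfl
      exact ht0 (by rw [hm, mul_zero])
    have hdiv : t / N = m := by rw [hm, Int.mul_ediv_cancel_left _ hN0]
    rw [hdiv, korobovFactor_of_ne_zero _ _ ht0, korobovFactor_of_ne_zero _ _ hm0, hm]
    push_cast
    rw [abs_mul, Nat.abs_cast, Real.mul_rpow (Nat.cast_nonneg _) (abs_nonneg _)]
    ring
  rw [Finset.sum_congr rfl key, ← Finset.mul_sum]
  refine mul_le_mul_of_nonneg_left ?_ (by positivity)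
  have hinj : Set.InjOn (fun t : ℤ => t / (N : ℤ)) ↑(T.filter (fun t => t ≠ 0 ∧ (N : ℤ) ∣ t)) := by
    intro t₁ h₁ t₂ h₂ he
    have d₁ := (Finset.mem_filter.mp h₁).2.2
    have d₂ := (Finset.mem_filter.mp h₂).2.2
    have he' : t₁ / (N : ℤ) = t₂ / (N : ℤ) := he
    rw [← Int.ediv_mul_cancel d₁, ← Int.ediv_mul_cancel d₂, he']
  rw [← Finset.sum_image hinj]
  have h1 : ∀ m ∈ (T.filter (fun t => t ≠ 0 ∧ (N : ℤ) ∣ t)).image (fun t : ℤ => t / (N : ℤ)),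
      korobovFactor b δ m = if m = 0 then 0 else korobovFactor b δ m := by
    intro m hm
    obtain ⟨t, ht, rfl⟩ := Finset.mem_image.mp hm
    obtain ⟨ht0, hdvd⟩ := (Finset.mem_filter.mp ht).2
    have hm0 : t / (N : ℤ) ≠ 0 := by
      intro h0
      apply ht0
      rw [← Int.ediv_mul_cancel hdvd, h0, zero_mul]
    rw [if_neg hm0]
  rw [Finset.sum_congr rfl h1]
  refine sum_le_hasSum _ (fun m _ => ?_) (hasSum_korobovFactor_ite hb δ)
  split_ifs
  · exact le_rfl
  · exact korobovFactor_nonneg b hδ m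

/-- **The one-dimensional averaging bound.**  For a prime `N`, `α > 1`, `γ ≥ 0`, an integer `c` and
any finite set `T` of last coordinates `t`:
`Σ_{t ∈ T, t ≠ 0} #{w ∈ {1,…,N-1} : c + t w ≡ 0 (N)} · r_{α,γ}(t)^{-1} ≤ 2γζ(α)`
(if `N ∤ c` each count is `≤ 1`; if `N ∣ c` only `t ∈ Nℤ` count, `N - 1` times each, and
`(N-1) N^{-α} ≤ 1`). [cite: DickPillichshammer2014, Thm. 21] -/
theorem sum_card_mul_korobovFactor_le {b : ℝ} (hb : 1 < b) {δ : ℝ} (hδ : 0 ≤ δ) {N : ℕ}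
    (hN : N.Prime) (c : ℤ) (T : Finset ℤ) :
    ∑ t ∈ T, (#{w ∈ cbcCandidates N | (N : ℤ) ∣ c + t * w ∧ t ≠ 0} : ℝ) * korobovFactor b δ t ≤
      2 * δ * zetaReal b := by
  have hN1 : 1 < N := hN.one_lt
  have hζ : 0 ≤ zetaReal b := zetaReal_nonneg' b
  -- remove the clause `t ≠ 0` from the filter for `t ≠ 0`, and kill the term `t = 0`
  have hsplit : ∀ t : ℤ, (#{w ∈ cbcCandidates N | (N : ℤ) ∣ c + t * w ∧ t ≠ 0} : ℝ) =
      if t = 0 then 0 else (#{w ∈ cbcCandidates N | (N : ℤ) ∣ c + t * w} : ℝ) := by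
    intro t
    split_ifs with ht
    · subst ht
      simp
    · congr 2
      exact Finset.filter_congr fun w _ => by simp [ht]
  simp_rw [hsplit]
  by_cases hc : (N : ℤ) ∣ c
  · -- only multiples of `N` count, at most `N - 1` times each
    have hpt : ∀ t ∈ T, (if t = 0 then 0 else (#{w ∈ cbcCandidates N | (N : ℤ) ∣ c + t * w} : ℝ)) *
        korobovFactor b δ t ≤
        if t ≠ 0 ∧ (N : ℤ) ∣ t then ((N : ℝ) - 1) * korobovFactor b δ t else 0 := by
      intro t _
      by_cases ht0 : t = 0
      · simp [ht0]
      rw [if_neg ht0]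
      by_cases hNt : (N : ℤ) ∣ t
      · rw [if_pos ⟨ht0, hNt⟩]
        refine mul_le_mul_of_nonneg_right ?_ (korobovFactor_nonneg b hδ t)
        have h1 : #{w ∈ cbcCandidates N | (N : ℤ) ∣ c + t * w} ≤ N - 1 :=
          (Finset.card_filter_le _ _).trans (card_cbcCandidates N).le
        calc (#{w ∈ cbcCandidates N | (N : ℤ) ∣ c + t * w} : ℝ) ≤ ((N - 1 : ℕ) : ℝ) := by
              exact_mod_cast h1
          _ = (N : ℝ) - 1 := by rw [Nat.cast_sub hN1.le, Nat.cast_one]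
      · rw [if_neg (fun h => hNt h.2), filter_dvd_eq_empty_of_dvd hN hc hNt, Finset.card_empty,
          Nat.cast_zero, zero_mul]
    refine (Finset.sum_le_sum hpt).trans ?_
    rw [← Finset.sum_filter, ← Finset.mul_sum]
    have hNb : (N : ℝ) ≤ (N : ℝ) ^ b := Real.self_le_rpow_of_one_le (by exact_mod_cast hN1.le) hb.le
    have hNpos : (0 : ℝ) < (N : ℝ) ^ b := by positivity
    calc ((N : ℝ) - 1) * ∑ t ∈ T with t ≠ 0 ∧ (N : ℤ) ∣ t, korobovFactor b δ t
        ≤ ((N : ℝ) - 1) * (((N : ℝ) ^ b)⁻¹ * (2 * δ * zetaReal b)) :=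
          mul_le_mul_of_nonneg_left (sum_korobovFactor_multiples_le hb hδ hN.pos T)
            (sub_nonneg.mpr (by exact_mod_cast hN1.le))
      _ = (((N : ℝ) - 1) * ((N : ℝ) ^ b)⁻¹) * (2 * δ * zetaReal b) := by ring
      _ ≤ 1 * (2 * δ * zetaReal b) := by
          refine mul_le_mul_of_nonneg_right ?_ (by positivity)
          rw [mul_inv_le_iff₀ hNpos, one_mul]
          linarith
      _ = 2 * δ * zetaReal b := one_mul _
  · -- every count is at most one
    have hpt : ∀ t ∈ T, (if t = 0 then 0 else (#{w ∈ cbcCandidates N | (N : ℤ) ∣ c + t * w} : ℝ)) *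
        korobovFactor b δ t ≤ if t = 0 then 0 else korobovFactor b δ t := by
      intro t _
      by_cases ht0 : t = 0
      · simp [ht0]
      rw [if_neg ht0, if_neg ht0]
      have hle : #{w ∈ cbcCandidates N | (N : ℤ) ∣ c + t * w} ≤ 1 := by
        by_cases hNt : (N : ℤ) ∣ t
        · rw [filter_dvd_eq_empty_of_not_dvd hc hNt, Finset.card_empty]
          exact zero_le_one
        · exact card_filter_dvd_le_one hN hNt c
      calc (#{w ∈ cbcCandidates N | (N : ℤ) ∣ c + t * w} : ℝ) * korobovFactor b δ t
          ≤ 1 * korobovFactor b δ t :=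
            mul_le_mul_of_nonneg_right (by exact_mod_cast hle) (korobovFactor_nonneg b hδ t)
        _ = korobovFactor b δ t := one_mul _
    refine (Finset.sum_le_sum hpt).trans ?_
    refine sum_le_hasSum T (fun t _ => ?_) (hasSum_korobovFactor_ite hb δ)
    split_ifs
    · exact le_rfl
    · exact korobovFactor_nonneg b hδ t

/-! ### Adding one component: `e²_d((g', z)) = e²_{d-1}(g') + θ(z)` -/

section CBC

variable {s : ℕ}

/-- `(𝐡', t) · (g', z) = 𝐡' · g' + t z`. [folklore] -/
private theorem sum_snoc_mul_snoc (h' : Fin s → ℤ) (t : ℤ) (z' : Fin s → ℤ) (w : ℤ) :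
    ∑ i : Fin (s + 1), (Fin.snoc h' t : Fin (s + 1) → ℤ) i * (Fin.snoc z' w : Fin (s + 1) → ℤ) i =
      (∑ j, h' j * z' j) + t * w := by
  rw [Fin.sum_univ_castSucc]
  simp only [Fin.snoc_castSucc, Fin.snoc_last]

/-- `(𝐡', t) ∈ L_{(g', z),N} ↔ 𝐡' · g' + t z ≡ 0 (mod N)`. [cite: DickPillichshammer2014, Thm. 21] -/
theorem snoc_mem_dualLattice_snoc {N : ℕ} {h' z' : Fin s → ℤ} {t w : ℤ} :
    (Fin.snoc h' t : Fin (s + 1) → ℤ) ∈ dualLattice N (Fin.snoc z' w : Fin (s + 1) → ℤ) ↔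
      (N : ℤ) ∣ (∑ j, h' j * z' j) + t * w := by
  rw [mem_dualLattice, sum_snoc_mul_snoc]

/-- `r_{α,γ}((𝐡', t))^{-1} = r_{α,γ'}(𝐡')^{-1} · r_{α,γ_d}(t)^{-1}` (product weights).
[cite: DickPillichshammer2014, Thm. 21] -/
theorem korobovWeightR_snoc (a : ℝ) (γ : Fin (s + 1) → ℝ) (h' : Fin s → ℤ) (t : ℤ) :
    korobovWeightR a γ (Fin.snoc h' t) =
      korobovWeightR a (fun j => γ j.castSucc) h' * korobovFactor a (γ (Fin.last s)) t := by
  rw [korobovWeightR, Fin.prod_univ_castSucc]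
  simp only [korobovWeightR, Fin.snoc_castSucc, Fin.snoc_last]

/-- `(𝐡', 0) = 0 ↔ 𝐡' = 0`. [folklore] -/
private theorem snoc_zero_eq_zero_iff (h' : Fin s → ℤ) : (Fin.snoc h' 0 : Fin (s + 1) → ℤ) = 0 ↔ h' = 0 := by
  constructor
  · intro h
    funext j
    have := congrFun h (Fin.castSucc j)
    rwa [Fin.snoc_castSucc] at this
  · rintro rfl
    funext i
    refine Fin.lastCases ?_ (fun j => ?_) i
    · simp only [Fin.snoc_last, Pi.zero_apply]
    · simp only [Fin.snoc_castSucc, Pi.zero_apply]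

/-- `θ(z) = θ_{α,γ}(g'; z) = Σ_{𝐡 ∈ L_{(g',z),N}, h_d ≠ 0} r_{α,γ}(𝐡)^{-1}`: the part of
`e²_d((g', z))` that depends on the new component `z` (`θ_s(z_s)` in Nuyens, Theorem 3).
[cite: DickPillichshammer2014, Thm. 21] -/
def cbcTheta (a : ℝ) (γ : Fin (s + 1) → ℝ) (N : ℕ) (z' : Fin s → ℤ) (w : ℤ) : ℝ :=
  ∑' h : Fin (s + 1) → ℤ,
    if h ∈ dualLattice N (Fin.snoc z' w : Fin (s + 1) → ℤ) ∧ h (Fin.last s) ≠ 0 then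
      korobovWeightR a γ h else 0

/-- `θ(z) ≥ 0` for nonnegative weights. [cite: Nuyens2014, Thm. 3] -/
theorem cbcTheta_nonneg (a : ℝ) {γ : Fin (s + 1) → ℝ} (hγ : ∀ i, 0 ≤ γ i) (N : ℕ)
    (z' : Fin s → ℤ) (w : ℤ) : 0 ≤ cbcTheta a γ N z' w :=
  tsum_nonneg fun h => by
    split_ifs
    · exact korobovWeightR_nonneg a hγ h
    · exact le_rfl

/-- **Splitting off the last component**: `e²_d((g', z)) = e²_{d-1}(g') + θ(z)`, since the
`𝐡 ∈ L_{(g',z),N} ∖ {0}` with `h_d = 0` are exactly the `(𝐡', 0)` with `𝐡' ∈ L_{g',N} ∖ {0}` and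
`r_{α,γ}((𝐡', 0))^{-1} = r_{α,γ'}(𝐡')^{-1}`. [cite: DickPillichshammer2014, Thm. 21] -/
theorem weightedPFigureR_snoc {a : ℝ} (ha : 1 < a) (γ : Fin (s + 1) → ℝ) (N : ℕ) (z' : Fin s → ℤ)
    (w : ℤ) :
    weightedPFigureR a γ (Fin.snoc z' w) N =
      weightedPFigureR a (fun j => γ j.castSucc) z' N + cbcTheta a γ N z' w := by
  classical
  -- the two truncations of `𝐡 ↦ r_{α,γ}(𝐡)^{-1}`
  have hA : Summable fun h : Fin (s + 1) → ℤ =>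
      if h ∈ dualLattice N (Fin.snoc z' w : Fin (s + 1) → ℤ) ∧ h ≠ 0 ∧ h (Fin.last s) = 0 then
        korobovWeightR a γ h else 0 := summable_ite_korobovWeightR ha γ _
  have hB : Summable fun h : Fin (s + 1) → ℤ =>
      if h ∈ dualLattice N (Fin.snoc z' w : Fin (s + 1) → ℤ) ∧ h (Fin.last s) ≠ 0 then
        korobovWeightR a γ h else 0 := summable_ite_korobovWeightR ha γ _
  have e1 : weightedPFigureR a γ (Fin.snoc z' w) N = ∑' h : Fin (s + 1) → ℤ,
      ((if h ∈ dualLattice N (Fin.snoc z' w : Fin (s + 1) → ℤ) ∧ h ≠ 0 ∧ h (Fin.last s) = 0 then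
          korobovWeightR a γ h else 0) +
        (if h ∈ dualLattice N (Fin.snoc z' w : Fin (s + 1) → ℤ) ∧ h (Fin.last s) ≠ 0 then
          korobovWeightR a γ h else 0)) := by
    rw [weightedPFigureR, _root_.tsum_subtype]
    refine tsum_congr fun h => ?_
    rw [Set.indicator_apply]
    simp only [Set.mem_sdiff, SetLike.mem_coe, Set.mem_singleton_iff]
    by_cases hl : h (Fin.last s) = 0
    · simp [hl]
    · have h0 : h ≠ 0 := by
        rintro rfl
        exact hl rfl
      simp [hl, h0]
  rw [e1, hA.tsum_add hB]
  congr 1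
  -- the first truncation is `e²_{d-1}(g')`, via `𝐡' ↦ (𝐡', 0)`
  rw [weightedPFigureR, _root_.tsum_subtype]
  have hinj : Function.Injective fun h' : Fin s → ℤ => (Fin.snoc h' 0 : Fin (s + 1) → ℤ) :=
    fun x y hxy => (Fin.snoc_injective2 hxy).1
  rw [← hinj.tsum_eq]
  · refine tsum_congr fun h' => ?_
    simp only [Set.indicator_apply, Set.mem_sdiff, SetLike.mem_coe, Set.mem_singleton_iff,
      snoc_mem_dualLattice_snoc, zero_mul, add_zero, Fin.snoc_last, korobovWeightR_snoc,
      korobovFactor_zero, mul_one, ne_eq, snoc_zero_eq_zero_iff, ← mem_dualLattice (z := z')]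
    by_cases hm : h' ∈ dualLattice N z' <;> by_cases h0 : h' = 0 <;> simp [hm, h0]
  · intro h hh
    rw [Function.mem_support] at hh
    have hl : h (Fin.last s) = 0 := by
      by_contra hl
      exact hh (if_neg fun hc => hl hc.2.2)
    exact ⟨Fin.init h, by
      show Fin.snoc (Fin.init h) 0 = h
      calc Fin.snoc (Fin.init h) (0 : ℤ) = Fin.snoc (Fin.init h) (h (Fin.last s)) := by rw [hl]
        _ = h := Fin.snoc_init_self h⟩

/-- `e²_0 = 0`: in dimension `0` the dual lattice minus the origin is empty.
[cite: DickPillichshammer2014, Thm. 21] -/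
theorem weightedPFigureR_fin_zero (a : ℝ) (γ : Fin 0 → ℝ) (z : Fin 0 → ℤ) (N : ℕ) :
    weightedPFigureR a γ z N = 0 := by
  haveI : IsEmpty (((dualLattice N z : Set (Fin 0 → ℤ)) \ {0} : Set (Fin 0 → ℤ))) :=
    ⟨fun h => h.2.2 (Set.mem_singleton_iff.mpr (Subsingleton.elim _ _))⟩
  exact tsum_empty

/-! ### Jensen's inequality `(Σ a_k)^λ ≤ Σ a_k^λ` (`0 < λ ≤ 1`) and `θ(z)^λ ≤ θ_λ(z)` -/

/-- Subadditivity of `t ↦ t^λ` (`0 < λ ≤ 1`): `(Σᵢ aᵢ)^λ ≤ Σᵢ aᵢ^λ` for `aᵢ ≥ 0` ("Jensen's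
inequality" in the proof of Theorem 21(1) / Nuyens, Theorem 3). [cite: Nuyens2014, Thm. 3] -/
theorem rpow_sum_le_sum_rpow_of_le_one {ι : Type*} (F : Finset ι) {f : ι → ℝ} (hf : ∀ i, 0 ≤ f i)
    {l : ℝ} (hl0 : 0 < l) (hl1 : l ≤ 1) : (∑ i ∈ F, f i) ^ l ≤ ∑ i ∈ F, f i ^ l := by
  classical
  induction F using Finset.induction_on with
  | empty => simp [Real.zero_rpow hl0.ne']
  | insert i F hi ih =>
    rw [Finset.sum_insert hi, Finset.sum_insert hi]
    exact (Real.rpow_add_le_add_rpow (hf i) (Finset.sum_nonneg fun j _ => hf j) hl0.le hl1).trans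
      (by linarith)

/-- Jensen's inequality for series: `(Σ' aᵢ)^λ ≤ Σ' aᵢ^λ` for `aᵢ ≥ 0`, `0 < λ ≤ 1`, whenever the
right-hand side converges. [cite: Nuyens2014, Thm. 3] -/
theorem rpow_tsum_le_tsum_rpow_of_le_one {ι : Type*} {f : ι → ℝ} (hf : ∀ i, 0 ≤ f i) {l : ℝ}
    (hl0 : 0 < l) (hl1 : l ≤ 1) (hs : Summable fun i => f i ^ l) :
    (∑' i, f i) ^ l ≤ ∑' i, f i ^ l := by
  set S := ∑' i, f i ^ l
  have hS : 0 ≤ S := tsum_nonneg fun i => Real.rpow_nonneg (hf i) l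
  have h1 : ∀ F : Finset ι, ∑ i ∈ F, f i ≤ S ^ l⁻¹ := by
    intro F
    have h2 : (∑ i ∈ F, f i) ^ l ≤ S :=
      (rpow_sum_le_sum_rpow_of_le_one F hf hl0 hl1).trans
        (hs.sum_le_tsum F fun i _ => Real.rpow_nonneg (hf i) l)
    calc ∑ i ∈ F, f i = ((∑ i ∈ F, f i) ^ l) ^ l⁻¹ :=
          (Real.rpow_rpow_inv (Finset.sum_nonneg fun i _ => hf i) hl0.ne').symm
      _ ≤ S ^ l⁻¹ :=
          Real.rpow_le_rpow (Real.rpow_nonneg (Finset.sum_nonneg fun i _ => hf i) l) h2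
            (inv_nonneg.mpr hl0.le)
  have h3 : ∑' i, f i ≤ S ^ l⁻¹ := Real.tsum_le_of_sum_le hf h1
  calc (∑' i, f i) ^ l ≤ (S ^ l⁻¹) ^ l := Real.rpow_le_rpow (tsum_nonneg hf) h3 hl0.le
    _ = S := Real.rpow_inv_rpow hS hl0.ne'

/-- `θ_{α,γ}(z)^λ ≤ θ_{αλ,γ^λ}(z)` for `0 < λ ≤ 1`, `αλ > 1` (Jensen's inequality and
`(r_{α,γ}(𝐡)^{-1})^λ = r_{αλ,γ^λ}(𝐡)^{-1}`). [cite: DickPillichshammer2014, Thm. 21] -/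
theorem cbcTheta_rpow_le {a l : ℝ} (hl0 : 0 < l) (hl1 : l ≤ 1) (hal : 1 < a * l)
    {γ : Fin (s + 1) → ℝ} (hγ : ∀ i, 0 ≤ γ i) (N : ℕ) (z' : Fin s → ℤ) (w : ℤ) :
    cbcTheta a γ N z' w ^ l ≤ cbcTheta (a * l) (fun i => γ i ^ l) N z' w := by
  unfold cbcTheta
  have hpt : ∀ h : Fin (s + 1) → ℤ,
      (if h ∈ dualLattice N (Fin.snoc z' w : Fin (s + 1) → ℤ) ∧ h (Fin.last s) ≠ 0 then
          korobovWeightR a γ h else 0) ^ l =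
        if h ∈ dualLattice N (Fin.snoc z' w : Fin (s + 1) → ℤ) ∧ h (Fin.last s) ≠ 0 then
          korobovWeightR (a * l) (fun i => γ i ^ l) h else 0 := by
    intro h
    split_ifs
    · exact korobovWeightR_rpow a hγ h l
    · exact Real.zero_rpow hl0.ne'
  have h0 : ∀ h : Fin (s + 1) → ℤ, 0 ≤
      (if h ∈ dualLattice N (Fin.snoc z' w : Fin (s + 1) → ℤ) ∧ h (Fin.last s) ≠ 0 then
        korobovWeightR a γ h else 0) := fun h => by
    split_ifs
    · exact korobovWeightR_nonneg a hγ h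
    · exact le_rfl
  have hs : Summable fun h : Fin (s + 1) → ℤ =>
      (if h ∈ dualLattice N (Fin.snoc z' w : Fin (s + 1) → ℤ) ∧ h (Fin.last s) ≠ 0 then
        korobovWeightR a γ h else 0) ^ l := by
    simp_rw [hpt]
    exact summable_ite_korobovWeightR hal _ _
  refine (rpow_tsum_le_tsum_rpow_of_le_one h0 hl0 hl1 hs).trans_eq (tsum_congr hpt)

/-! ### The averaging argument: `Σ_{z=1}^{N-1} θ_λ(z) ≤ 2γ_d^λ ζ(αλ) ∏_{j<d} (1 + 2γ_j^λ ζ(αλ))` -/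

/-- Finite form of the averaging bound: for every finite set `F` of frequencies `𝐡 = (𝐡', t)`,
`Σ_{𝐡 ∈ F} #{z ∈ {1,…,N-1} : 𝐡 ∈ L_{(g',z),N}, t ≠ 0} · r_{α,γ}(𝐡)^{-1}
  ≤ 2γ_d ζ(α) ∏_{j<d} (1 + 2γ_j ζ(α))`. [folklore] -/
private theorem sum_card_mul_korobovWeightR_le {b : ℝ} (hb : 1 < b) {δ : Fin (s + 1) → ℝ}
    (hδ : ∀ i, 0 ≤ δ i) {N : ℕ} (hN : N.Prime) (z' : Fin s → ℤ) (F : Finset (Fin (s + 1) → ℤ)) :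
    ∑ h ∈ F, (#{w ∈ cbcCandidates N | h ∈ dualLattice N (Fin.snoc z' w : Fin (s + 1) → ℤ) ∧
        h (Fin.last s) ≠ 0} : ℝ) * korobovWeightR b δ h ≤
      2 * δ (Fin.last s) * zetaReal b * ∏ j : Fin s, (1 + 2 * δ j.castSucc * zetaReal b) := by
  classical
  set g : (Fin (s + 1) → ℤ) → ℝ := fun h =>
    (#{w ∈ cbcCandidates N | h ∈ dualLattice N (Fin.snoc z' w : Fin (s + 1) → ℤ) ∧
        h (Fin.last s) ≠ 0} : ℝ) * korobovWeightR b δ h with hg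
  have g0 : ∀ h, 0 ≤ g h := fun h => mul_nonneg (Nat.cast_nonneg _) (korobovWeightR_nonneg b hδ h)
  have hζ : 0 ≤ zetaReal b := zetaReal_nonneg' b
  -- `F ⊆ {(𝐡', t) : 𝐡' ∈ H', t ∈ T}`
  set H' : Finset (Fin s → ℤ) := F.image Fin.init with hH'
  set T : Finset ℤ := F.image fun h => h (Fin.last s) with hT
  have hsub : F ⊆ (H' ×ˢ T).image (fun p => (Fin.snoc p.1 p.2 : Fin (s + 1) → ℤ)) := by
    intro h hh
    refine Finset.mem_image.mpr ⟨(Fin.init h, h (Fin.last s)), Finset.mem_product.mpr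
      ⟨Finset.mem_image_of_mem _ hh, Finset.mem_image_of_mem (fun h => h (Fin.last s)) hh⟩, ?_⟩
    exact Fin.snoc_init_self h
  have hinj : Set.InjOn (fun p : (Fin s → ℤ) × ℤ => (Fin.snoc p.1 p.2 : Fin (s + 1) → ℤ))
      ↑(H' ×ˢ T) := by
    intro p _ q _ he
    obtain ⟨h1, h2⟩ := Fin.snoc_injective2 he
    exact Prod.ext h1 h2
  -- the inner sum over `t` for fixed `𝐡'`
  have inner : ∀ h' : Fin s → ℤ, ∑ t ∈ T, g (Fin.snoc h' t) ≤
      korobovWeightR b (fun j => δ j.castSucc) h' * (2 * δ (Fin.last s) * zetaReal b) := by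
    intro h'
    have e : ∀ t ∈ T, g (Fin.snoc h' t) = korobovWeightR b (fun j => δ j.castSucc) h' *
        ((#{w ∈ cbcCandidates N | (N : ℤ) ∣ (∑ j, h' j * z' j) + t * w ∧ t ≠ 0} : ℝ) *
          korobovFactor b (δ (Fin.last s)) t) := by
      intro t _
      simp only [hg, snoc_mem_dualLattice_snoc, Fin.snoc_last, korobovWeightR_snoc]
      ring
    rw [Finset.sum_congr rfl e, ← Finset.mul_sum]
    exact mul_le_mul_of_nonneg_left
      (sum_card_mul_korobovFactor_le hb (hδ _) hN _ T) (korobovWeightR_nonneg b (fun j => hδ _) h')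
  calc ∑ h ∈ F, g h
      ≤ ∑ h ∈ (H' ×ˢ T).image (fun p => (Fin.snoc p.1 p.2 : Fin (s + 1) → ℤ)), g h :=
        Finset.sum_le_sum_of_subset_of_nonneg hsub fun h _ _ => g0 h
    _ = ∑ p ∈ H' ×ˢ T, g (Fin.snoc p.1 p.2) := Finset.sum_image hinj
    _ = ∑ h' ∈ H', ∑ t ∈ T, g (Fin.snoc h' t) := Finset.sum_product _ _ _
    _ ≤ ∑ h' ∈ H', korobovWeightR b (fun j => δ j.castSucc) h' * (2 * δ (Fin.last s) * zetaReal b) :=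
        Finset.sum_le_sum fun h' _ => inner h'
    _ = (∑ h' ∈ H', korobovWeightR b (fun j => δ j.castSucc) h') *
          (2 * δ (Fin.last s) * zetaReal b) := (Finset.sum_mul _ _ _).symm
    _ ≤ (∏ j : Fin s, (1 + 2 * δ j.castSucc * zetaReal b)) * (2 * δ (Fin.last s) * zetaReal b) :=
        mul_le_mul_of_nonneg_right (sum_korobovWeightR_le hb (fun j => hδ _) H')
          (by have := hδ (Fin.last s); positivity)
    _ = _ := by ring

/-- **The averaging bound** (Kuo's induction step; Lemma 1 of Ebert–Leövey–Nuyens in the variant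
over `z ∈ {1, …, N-1}`): for a prime `N`, `α > 1` and `γ ≥ 0`,
`Σ_{z=1}^{N-1} θ_{α,γ}(g'; z) ≤ 2γ_d ζ(α) ∏_{j<d} (1 + 2γ_j ζ(α))`, for every `g' ∈ ℤ^{d-1}`.
[cite: DickPillichshammer2014, Thm. 21] -/
theorem sum_cbcTheta_le {b : ℝ} (hb : 1 < b) {δ : Fin (s + 1) → ℝ} (hδ : ∀ i, 0 ≤ δ i) {N : ℕ}
    (hN : N.Prime) (z' : Fin s → ℤ) :
    ∑ w ∈ cbcCandidates N, cbcTheta b δ N z' w ≤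
      2 * δ (Fin.last s) * zetaReal b * ∏ j : Fin s, (1 + 2 * δ j.castSucc * zetaReal b) := by
  unfold cbcTheta
  rw [← Summable.tsum_finsetSum (fun w _ => summable_ite_korobovWeightR hb δ _)]
  have hterm : ∀ h : Fin (s + 1) → ℤ, ∑ w ∈ cbcCandidates N,
      (if h ∈ dualLattice N (Fin.snoc z' w : Fin (s + 1) → ℤ) ∧ h (Fin.last s) ≠ 0 then
        korobovWeightR b δ h else 0) =
      (#{w ∈ cbcCandidates N | h ∈ dualLattice N (Fin.snoc z' w : Fin (s + 1) → ℤ) ∧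
        h (Fin.last s) ≠ 0} : ℝ) * korobovWeightR b δ h := by
    intro h
    rw [← Finset.sum_filter, Finset.sum_const, nsmul_eq_mul]
  rw [tsum_congr hterm]
  exact Real.tsum_le_of_sum_le
    (fun h => mul_nonneg (Nat.cast_nonneg _) (korobovWeightR_nonneg b hδ h))
    (sum_card_mul_korobovWeightR_le hb hδ hN z')

/-! ### Algorithm 20 (component-by-component construction) and Theorem 21(1) -/

/-- One step of **Algorithm 20**: given `g' = (g_1, …, g_{d-1})`, the component `z ∈ {1, …, N-1}`
minimises `e²(H(K_{d,α,γ}); P((g', z), N))` over `{1, …, N-1}`.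
[cite: DickPillichshammer2014, Thm. 21] -/
def IsCBCStep (a : ℝ) (γ : Fin (s + 1) → ℝ) (N : ℕ) (z' : Fin s → ℤ) (w : ℤ) : Prop :=
  w ∈ cbcCandidates N ∧ ∀ w' ∈ cbcCandidates N,
    weightedPFigureR a γ (Fin.snoc z' w) N ≤ weightedPFigureR a γ (Fin.snoc z' w') N

/-- In a CBC step the minimiser also minimises `θ`: `θ(g_d) ≤ θ(z)` for all `z ∈ {1, …, N-1}`
("only `θ_s(z_s)` needs to be evaluated", Nuyens §5). [cite: DickPillichshammer2014, Thm. 21] -/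
theorem cbcTheta_le_of_isCBCStep {a : ℝ} (ha : 1 < a) {γ : Fin (s + 1) → ℝ} {N : ℕ}
    {z' : Fin s → ℤ} {w : ℤ} (hw : IsCBCStep a γ N z' w) {w' : ℤ} (hw' : w' ∈ cbcCandidates N) :
    cbcTheta a γ N z' w ≤ cbcTheta a γ N z' w' := by
  have h := hw.2 w' hw'
  rw [weightedPFigureR_snoc ha, weightedPFigureR_snoc ha] at h
  linarith

/-- For the first component (`d = 1`) every `z ∈ {1, …, N-1}` gives the same error when `N` is
prime (`h z ≡ 0 ↔ h ≡ 0 (mod N)`), so step 1 of Algorithm 20, "choose `g_1 = 1`", is a minimising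
choice. [cite: DickPillichshammer2014, Thm. 21] -/
theorem isCBCStep_zero_iff {a : ℝ} (ha : 1 < a) (γ : Fin 1 → ℝ) {N : ℕ} (hN : N.Prime)
    (z' : Fin 0 → ℤ) (w : ℤ) : IsCBCStep a γ N z' w ↔ w ∈ cbcCandidates N := by
  refine ⟨fun h => h.1, fun hw => ⟨hw, fun w' hw' => ?_⟩⟩
  have hp : Prime (N : ℤ) := Nat.prime_iff_prime_int.mp hN
  -- `θ(w) = θ(w')`: membership of `𝐡` in the dual lattice does not depend on `w ∈ {1,…,N-1}`
  have key : ∀ {v : ℤ}, v ∈ cbcCandidates N → ∀ h : Fin 1 → ℤ,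
      (h ∈ dualLattice N (Fin.snoc z' v : Fin 1 → ℤ) ↔ (N : ℤ) ∣ h (Fin.last 0)) := by
    intro v hv h
    rw [mem_dualLattice, Fin.sum_univ_castSucc, Finset.univ_eq_empty, Finset.sum_empty, zero_add,
      Fin.snoc_last]
    exact ⟨fun hd => (hp.dvd_or_dvd hd).resolve_right (not_dvd_of_mem_cbcCandidates hv),
      fun hd => hd.mul_right v⟩
  have hθ : cbcTheta a γ N z' w = cbcTheta a γ N z' w' := by
    unfold cbcTheta
    refine tsum_congr fun h => ?_
    simp only [key hw, key hw']
  rw [weightedPFigureR_snoc ha, weightedPFigureR_snoc ha, hθ]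

end CBC

/-- The output of **Algorithm 20**: `IsCBC α N γ g` says that every component `g_d ∈ {1, …, N-1}`
of `g = (g_1, …, g_s)` minimises `e²(H(K_{d,α,γ}); P((g_1, …, g_{d-1}, z), N))` over
`z ∈ {1, …, N-1}` (for `d = 1` all choices, in particular `g_1 = 1`, are minimisers, see
`isCBCStep_zero_iff`). [cite: DickPillichshammer2014, Thm. 21] -/
def IsCBC (a : ℝ) (N : ℕ) : {s : ℕ} → (Fin s → ℝ) → (Fin s → ℤ) → Prop
  | 0, _, _ => True
  | s + 1, γ, z => IsCBC a N (fun j : Fin s => γ j.castSucc) (fun j : Fin s => z j.castSucc) ∧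
      IsCBCStep a γ N (fun j : Fin s => z j.castSucc) (z (Fin.last s))

/-- `IsCBC` in dimension `0` is trivially true. [cite: DickPillichshammer2014, Thm. 21] -/
@[simp] theorem isCBC_zero (a : ℝ) (N : ℕ) (γ : Fin 0 → ℝ) (z : Fin 0 → ℤ) : IsCBC a N γ z :=
  trivial

/-- `IsCBC` in dimension `d`: `IsCBC` for the first `d - 1` components and a CBC step for the last.
[cite: DickPillichshammer2014, Thm. 21] -/
theorem isCBC_succ_iff (a : ℝ) (N : ℕ) {s : ℕ} (γ : Fin (s + 1) → ℝ) (z : Fin (s + 1) → ℤ) :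
    IsCBC a N γ z ↔ IsCBC a N (fun j : Fin s => γ j.castSucc) (fun j : Fin s => z j.castSucc) ∧
      IsCBCStep a γ N (fun j : Fin s => z j.castSucc) (z (Fin.last s)) :=
  Iff.rfl

/-- `IsCBC` for `(g', z)` from `IsCBC` for `g'` and a CBC step. [cite: DickPillichshammer2014, Thm. 21] -/
theorem isCBC_snoc {a : ℝ} {N : ℕ} {s : ℕ} {γ : Fin (s + 1) → ℝ} {z' : Fin s → ℤ} {w : ℤ}
    (hz' : IsCBC a N (fun j : Fin s => γ j.castSucc) z') (hw : IsCBCStep a γ N z' w) :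
    IsCBC a N γ (Fin.snoc z' w) := by
  rw [isCBC_succ_iff]
  simp only [Fin.snoc_castSucc, Fin.snoc_last]
  exact ⟨hz', hw⟩

/-- **Algorithm 20 terminates**: for `N ≥ 2` a CBC vector exists for every `s` and all weights
(each step minimises over the nonempty finite set `{1, …, N-1}`). [cite: DickPillichshammer2014, Thm. 21] -/
theorem exists_isCBC (a : ℝ) {N : ℕ} (hN : 2 ≤ N) :
    ∀ (s : ℕ) (γ : Fin s → ℝ), ∃ z : Fin s → ℤ, IsCBC a N γ z
  | 0, _ => ⟨Fin.elim0, trivial⟩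
  | s + 1, γ => by
      obtain ⟨z', hz'⟩ := exists_isCBC a hN s (fun j => γ j.castSucc)
      have hne : (cbcCandidates N).Nonempty := ⟨1, by rw [mem_cbcCandidates]; omega⟩
      obtain ⟨w, hw, hmin⟩ := Finset.exists_min_image (cbcCandidates N)
        (fun w => weightedPFigureR a γ (Fin.snoc z' w) N) hne
      exact ⟨Fin.snoc z' w, isCBC_snoc hz' ⟨hw, hmin⟩⟩

/-- **Algorithm 20 with `g_1 = 1`**: for a prime `N` and `α > 1` there is a CBC vector with first
component `1`, as prescribed by step 1 of Algorithm 20. [cite: DickPillichshammer2014, Thm. 21] -/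
theorem exists_isCBC_apply_zero_eq_one {a : ℝ} (ha : 1 < a) {N : ℕ} (hN : N.Prime) :
    ∀ (s : ℕ) (γ : Fin (s + 1) → ℝ), ∃ z : Fin (s + 1) → ℤ, IsCBC a N γ z ∧ z 0 = 1
  | 0, γ => by
      have h1 : (1 : ℤ) ∈ cbcCandidates N := by
        rw [mem_cbcCandidates]
        have := hN.two_le
        omega
      refine ⟨fun _ => 1, ?_, rfl⟩
      rw [isCBC_succ_iff]
      exact ⟨trivial, (isCBCStep_zero_iff ha γ hN _ 1).mpr h1⟩
  | s + 1, γ => by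
      obtain ⟨z', hz', h0⟩ := exists_isCBC_apply_zero_eq_one ha hN s (fun j => γ j.castSucc)
      have hne : (cbcCandidates N).Nonempty := ⟨1, by rw [mem_cbcCandidates]; have := hN.two_le; omega⟩
      obtain ⟨w, hw, hmin⟩ := Finset.exists_min_image (cbcCandidates N)
        (fun w => weightedPFigureR a γ (Fin.snoc z' w) N) hne
      refine ⟨Fin.snoc z' w, isCBC_snoc hz' ⟨hw, hmin⟩, ?_⟩
      rw [← Fin.castSucc_zero, Fin.snoc_castSucc, h0]

/-- **Theorem 21(1), inductive form** (Kuo's induction): for a prime `N`, `0 < λ ≤ 1` with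
`αλ > 1`, nonnegative weights and a CBC vector `g ∈ {1,…,N-1}^s`,
`e²(H(K_{s,α,γ}); P(g, N))^λ ≤ ((∏_{j=1}^s (1 + 2γ_j^λ ζ(αλ))) - 1) / (N - 1)`.
[cite: DickPillichshammer2014, Thm. 21] -/
theorem weightedPFigureR_rpow_le_of_isCBC {a l : ℝ} (hl0 : 0 < l) (hl1 : l ≤ 1) (hal : 1 < a * l)
    {N : ℕ} (hN : N.Prime) :
    ∀ {s : ℕ} {γ : Fin s → ℝ} (_ : ∀ j, 0 ≤ γ j) {z : Fin s → ℤ} (_ : IsCBC a N γ z),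
      weightedPFigureR a γ z N ^ l ≤
        ((∏ j, (1 + 2 * γ j ^ l * zetaReal (a * l))) - 1) / ((N : ℝ) - 1)
  | 0, γ, _, z, _ => by
      rw [weightedPFigureR_fin_zero, Real.zero_rpow hl0.ne']
      simp
  | s + 1, γ, hγ, z, hz => by
      have ha : 1 < a := by nlinarith
      have hN1 : (0 : ℝ) < (N : ℝ) - 1 := sub_pos.mpr (by exact_mod_cast hN.one_lt)
      obtain ⟨hz', hstep⟩ := hz
      have IH := weightedPFigureR_rpow_le_of_isCBC hl0 hl1 hal hN (fun j => hγ j.castSucc) hz'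
      have hzs : (Fin.snoc (fun j : Fin s => z j.castSucc) (z (Fin.last s)) : Fin (s + 1) → ℤ) = z :=
        Fin.snoc_init_self z
      -- nonnegativity of the two parts
      have he' : 0 ≤ weightedPFigureR a (fun j : Fin s => γ j.castSucc) (fun j => z j.castSucc) N :=
        weightedPFigureR_nonneg a (fun j => hγ _) _ N
      have hθ : 0 ≤ cbcTheta a γ N (fun j => z j.castSucc) (z (Fin.last s)) :=
        cbcTheta_nonneg a hγ N _ _
      -- `θ(g_d)^λ ≤ (N-1)^{-1} Σ_z θ_λ(z) ≤ (N-1)^{-1} 2γ_d^λ ζ(αλ) ∏_{j<d} (1 + 2γ_j^λ ζ(αλ))`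
      have hθb : cbcTheta a γ N (fun j => z j.castSucc) (z (Fin.last s)) ^ l ≤
          ((N : ℝ) - 1)⁻¹ * (2 * γ (Fin.last s) ^ l * zetaReal (a * l) *
            ∏ j : Fin s, (1 + 2 * γ j.castSucc ^ l * zetaReal (a * l))) := by
        have h1 : ∀ w' ∈ cbcCandidates N, cbcTheta a γ N (fun j => z j.castSucc) (z (Fin.last s)) ^ l ≤
            cbcTheta (a * l) (fun i => γ i ^ l) N (fun j => z j.castSucc) w' := fun w' hw' =>
          (Real.rpow_le_rpow hθ (cbcTheta_le_of_isCBCStep ha hstep hw') hl0.le).trans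
            (cbcTheta_rpow_le hl0 hl1 hal hγ N _ w')
        have h2 := Finset.card_nsmul_le_sum (cbcCandidates N) _ _ h1
        rw [card_cbcCandidates, nsmul_eq_mul, Nat.cast_sub hN.one_lt.le, Nat.cast_one] at h2
        have h3 := sum_cbcTheta_le hal (δ := fun i => γ i ^ l) (fun i => Real.rpow_nonneg (hγ i) l)
          hN (fun j => z j.castSucc)
        rw [inv_mul_eq_div, le_div_iff₀ hN1]
        linarith
      calc weightedPFigureR a γ z N ^ l
          = (weightedPFigureR a (fun j : Fin s => γ j.castSucc) (fun j => z j.castSucc) N +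
              cbcTheta a γ N (fun j => z j.castSucc) (z (Fin.last s))) ^ l := by
            rw [← weightedPFigureR_snoc ha γ N, hzs]
        _ ≤ weightedPFigureR a (fun j : Fin s => γ j.castSucc) (fun j => z j.castSucc) N ^ l +
              cbcTheta a γ N (fun j => z j.castSucc) (z (Fin.last s)) ^ l :=
            Real.rpow_add_le_add_rpow he' hθ hl0.le hl1
        _ ≤ ((∏ j : Fin s, (1 + 2 * γ j.castSucc ^ l * zetaReal (a * l))) - 1) / ((N : ℝ) - 1) +
              ((N : ℝ) - 1)⁻¹ * (2 * γ (Fin.last s) ^ l * zetaReal (a * l) *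
                ∏ j : Fin s, (1 + 2 * γ j.castSucc ^ l * zetaReal (a * l))) := add_le_add IH hθb
        _ = ((∏ j : Fin (s + 1), (1 + 2 * γ j ^ l * zetaReal (a * l))) - 1) / ((N : ℝ) - 1) := by
            rw [Fin.prod_univ_castSucc]
            ring

/-- **Theorem 21(1), sharp intermediate form** (the constant `(N-1)^{-1}` delivered by the
averaging argument over `{1, …, N-1}`, cf. Kuo [66]; Theorem 21(1) prints the weaker `2/N`): for
a prime `N`, `1/α < λ ≤ 1`, nonnegative weights and a vector `g` constructed by Algorithm 20,
`e²(H(K_{s,α,γ}); P(g, N)) ≤ ((N-1)^{-1} ∏_{i=1}^s (1 + 2γ_i^λ ζ(αλ)))^{1/λ}`.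
[cite: DickPillichshammer2014, Thm. 21] -/
theorem weightedPFigureR_le_of_isCBC_sharp {a l : ℝ} (hl0 : 0 < l) (hl1 : l ≤ 1)
    (hal : 1 < a * l) {N : ℕ} (hN : N.Prime) {s : ℕ} {γ : Fin s → ℝ} (hγ : ∀ j, 0 ≤ γ j)
    {z : Fin s → ℤ} (hz : IsCBC a N γ z) :
    weightedPFigureR a γ z N ≤
      (((N : ℝ) - 1)⁻¹ * ∏ j, (1 + 2 * γ j ^ l * zetaReal (a * l))) ^ (1 / l) := by
  have h := weightedPFigureR_rpow_le_of_isCBC hl0 hl1 hal hN hγ hz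
  have he : 0 ≤ weightedPFigureR a γ z N := weightedPFigureR_nonneg a hγ z N
  have hN1 : (0 : ℝ) < (N : ℝ) - 1 := sub_pos.mpr (by exact_mod_cast hN.one_lt)
  have h' : weightedPFigureR a γ z N ^ l ≤
      ((N : ℝ) - 1)⁻¹ * ∏ j, (1 + 2 * γ j ^ l * zetaReal (a * l)) := by
    refine h.trans ?_
    rw [inv_mul_eq_div, div_le_div_iff_of_pos_right hN1]
    linarith
  calc weightedPFigureR a γ z N = (weightedPFigureR a γ z N ^ l) ^ (1 / l) := by
        rw [one_div, Real.rpow_rpow_inv he hl0.ne']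
    _ ≤ _ := Real.rpow_le_rpow (Real.rpow_nonneg he l) h' (by positivity)

/-- A product of factors `≥ 1` is `≥ 1`. [folklore] -/
private theorem one_le_prod_of_one_le' {ι : Type*} (S : Finset ι) (f : ι → ℝ)
    (h : ∀ i ∈ S, 1 ≤ f i) : 1 ≤ ∏ i ∈ S, f i := by
  calc (1 : ℝ) = ∏ _i ∈ S, (1 : ℝ) := Finset.prod_const_one.symm
    _ ≤ ∏ i ∈ S, f i := Finset.prod_le_prod (fun _ _ => zero_le_one) h

/-- **Theorem 21(1)** (Dick–Pillichshammer 2014, after Kuo [66]): for any prime `N`, a vector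
`g` found by Algorithm 20 satisfies, for `1/α < λ ≤ 1` and nonnegative product weights,
`e²(H(K_{s,α,γ}); P(g, N)) ≤ (2/N)^{1/λ} ∏_{i=1}^s (1 + 2γ_i^λ ζ(αλ))^{1/λ}`.
[cite: DickPillichshammer2014, Thm. 21] -/
theorem weightedPFigureR_le_of_isCBC {a l : ℝ} (hl0 : 0 < l) (hl1 : l ≤ 1) (hal : 1 < a * l)
    {N : ℕ} (hN : N.Prime) {s : ℕ} {γ : Fin s → ℝ} (hγ : ∀ j, 0 ≤ γ j) {z : Fin s → ℤ}
    (hz : IsCBC a N γ z) :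
    weightedPFigureR a γ z N ≤
      (2 / N) ^ (1 / l) * ∏ j, (1 + 2 * γ j ^ l * zetaReal (a * l)) ^ (1 / l) := by
  have hζ : 0 ≤ zetaReal (a * l) := zetaReal_nonneg' _
  have hf1 : ∀ j ∈ (Finset.univ : Finset (Fin s)), 1 ≤ 1 + 2 * γ j ^ l * zetaReal (a * l) :=
    fun j _ => by have := Real.rpow_nonneg (hγ j) l; nlinarith
  have hf0 : ∀ j ∈ (Finset.univ : Finset (Fin s)), 0 ≤ 1 + 2 * γ j ^ l * zetaReal (a * l) :=
    fun j hj => zero_le_one.trans (hf1 j hj)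
  set A := ∏ j, (1 + 2 * γ j ^ l * zetaReal (a * l)) with hA
  have hA0 : 0 ≤ A := Finset.prod_nonneg hf0
  have hN2 : (2 : ℝ) ≤ N := by exact_mod_cast hN.two_le
  have hN1 : (0 : ℝ) < (N : ℝ) - 1 := by linarith
  have hNpos : (0 : ℝ) < N := by linarith
  have hcmp : ((N : ℝ) - 1)⁻¹ * A ≤ 2 / N * A := by
    refine mul_le_mul_of_nonneg_right ?_ hA0
    rw [inv_eq_one_div, div_le_div_iff₀ hN1 hNpos]
    linarith
  calc weightedPFigureR a γ z N ≤ (((N : ℝ) - 1)⁻¹ * A) ^ (1 / l) :=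
        weightedPFigureR_le_of_isCBC_sharp hl0 hl1 hal hN hγ hz
    _ ≤ (2 / N * A) ^ (1 / l) :=
        Real.rpow_le_rpow (mul_nonneg (inv_nonneg.mpr hN1.le) hA0) hcmp (by positivity)
    _ = (2 / N) ^ (1 / l) * A ^ (1 / l) := Real.mul_rpow (by positivity) hA0
    _ = (2 / N) ^ (1 / l) * ∏ j, (1 + 2 * γ j ^ l * zetaReal (a * l)) ^ (1 / l) := by
        rw [hA, ← Real.finsetProd_rpow _ _ hf0]

/-- **Theorem 21(1)** for the integer smoothness parameter `α` of `KorobovBernoulliForm`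
(`e² = weightedPFigure α γ g N`). [cite: DickPillichshammer2014, Thm. 21] -/
theorem weightedPFigure_le_of_isCBC {α : ℕ} {l : ℝ} (hl0 : 0 < l) (hl1 : l ≤ 1)
    (hal : 1 < (α : ℝ) * l) {N : ℕ} (hN : N.Prime) {s : ℕ} {γ : Fin s → ℝ} (hγ : ∀ j, 0 ≤ γ j)
    {z : Fin s → ℤ} (hz : IsCBC (α : ℝ) N γ z) :
    weightedPFigure α γ z N ≤
      (2 / N) ^ (1 / l) * ∏ j, (1 + 2 * γ j ^ l * zetaReal ((α : ℝ) * l)) ^ (1 / l) := by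
  rw [weightedPFigure_eq_weightedPFigureR]
  exact weightedPFigureR_le_of_isCBC hl0 hl1 hal hN hγ hz

/-- **Theorem 21(1), unweighted case** (`γ = (1, 1, …)`, "we simply write `r_α`"): for a prime
`N`, `1/α < λ ≤ 1` and a CBC vector `g`, Niederreiter's
`P_α(g, N) ≤ ((N-1)^{-1} (1 + 2ζ(αλ))^s)^{1/λ}`. [cite: DickPillichshammer2014, Thm. 21] -/
theorem pFigure_le_of_isCBC {a l : ℝ} (hl0 : 0 < l) (hl1 : l ≤ 1) (hal : 1 < a * l) {N : ℕ}
    (hN : N.Prime) {s : ℕ} {z : Fin s → ℤ} (hz : IsCBC a N (fun _ => (1 : ℝ)) z) :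
    pFigure a z N ≤ (((N : ℝ) - 1)⁻¹ * (1 + 2 * zetaReal (a * l)) ^ s) ^ (1 / l) := by
  have h := weightedPFigureR_le_of_isCBC_sharp hl0 hl1 hal hN (fun _ => zero_le_one) hz
  rw [pFigure_eq_weightedPFigureR]
  simpa only [Real.one_rpow, mul_one, Finset.prod_const, Finset.card_univ, Fintype.card_fin] using h

/-- **Strong tractability form of Theorem 21(1)** (the display following Theorem 21 in §9.4.1,
after Sloan–Woźniakowski [111]): since `1 + x ≤ e^x`,
`e²(H(K_{s,α,γ}); P(g, N)) ≤ (2/N)^{1/λ} exp(λ^{-1} Σ_{i=1}^s 2γ_i^λ ζ(αλ))`, a bound that stays finite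
uniformly in `s` whenever `Σ_i γ_i^λ < ∞`. [cite: DickPillichshammer2014, Thm. 21] -/
theorem weightedPFigureR_le_exp_of_isCBC {a l : ℝ} (hl0 : 0 < l) (hl1 : l ≤ 1) (hal : 1 < a * l)
    {N : ℕ} (hN : N.Prime) {s : ℕ} {γ : Fin s → ℝ} (hγ : ∀ j, 0 ≤ γ j) {z : Fin s → ℤ}
    (hz : IsCBC a N γ z) :
    weightedPFigureR a γ z N ≤
      (2 / N) ^ (1 / l) * Real.exp ((1 / l) * ∑ j, 2 * γ j ^ l * zetaReal (a * l)) := by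
  have hζ : 0 ≤ zetaReal (a * l) := zetaReal_nonneg' _
  have hx : ∀ j, 0 ≤ 2 * γ j ^ l * zetaReal (a * l) := fun j => by
    have := Real.rpow_nonneg (hγ j) l; positivity
  refine (weightedPFigureR_le_of_isCBC hl0 hl1 hal hN hγ hz).trans
    (mul_le_mul_of_nonneg_left ?_ (by positivity))
  rw [Finset.mul_sum, Real.exp_sum]
  refine Finset.prod_le_prod (fun j _ => by have := hx j; positivity) fun j _ => ?_
  calc (1 + 2 * γ j ^ l * zetaReal (a * l)) ^ (1 / l)
      ≤ Real.exp (2 * γ j ^ l * zetaReal (a * l)) ^ (1 / l) :=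
        Real.rpow_le_rpow (by have := hx j; positivity)
          (by have := Real.add_one_le_exp (2 * γ j ^ l * zetaReal (a * l)); linarith)
          (by positivity)
    _ = Real.exp (1 / l * (2 * γ j ^ l * zetaReal (a * l))) := by
        rw [← Real.exp_mul, mul_comm]

end Literature.Analysis.Quadrature

end
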